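import Mathlib
import Summits.Ventures.HodgeRepro.Tier4.Target
import Summits.Ventures.HodgeRepro.Tier4.Line3.Defs
import Summits.Ventures.HodgeRepro.Tier4.Line3.LocaliserS
import Summits.Ventures.HodgeRepro.Tier4.Line3.HeckeEquivarianceLemmas
import Summits.Ventures.HodgeRepro.Tier4.Line3.GrowthInvOfGauss

/-!
# Tier4/Line3/HeckeMassBounds — (G₀-b): the coset representatives of a Hecke element are unitary; the (G₀) clauses

Blind re-derivation cell `pub-hodge-repro`, Tier 4 «PROVE THE STEP» (README §9–§10), LINE L3, seat t4-L2-p1 g2: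
piece (G₀-b) of the (G₀) cut (lead S13215 / S13252, split by t4-plan-3 g2 S13245; statement VERBATIM from
proofs/t4-plan-3/Tier4/Line3/G0Cut-sketch.lean) and the two clauses of that cut that name no ℓ¹-mass.

(G₀) `GaussGrowth D ℓ` is the pointwise Gauss-growth clause of a localiser (the hypothesis of `growthInv_of_gaussGrowth`,
GrowthInvOfGauss p675191, verbatim).  The cut derives it from (cf-G) `SlotGauss D` — the slot functions bounded by a
constant times the product of the definite Gaussians (= `ThetaData.decay` with exponent `0`, SlotGaussOfDecay
p676330) — and an ℓ¹-mass clause on the localising combination.  Piece (G₀-a), the ℓ¹ bound of the Hecke action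
`‖heckeAct h c x‖ ≤ (Σ_t |n_t| |R_t|) · sup_r ‖c (r x)‖`, is t4-L2-p3 g3's `norm_heckeAct_le` (with its `heckeSize` /
`trSize`, module GrowthInvOfMajorant) — the name is taken in the tree (gate dedup), so it is NOT re-declared here and the
ℓ¹-mass clause is left to be stated on `trSize` by the composition (G₀-c).  Piece (G₀-b) is proved here:

* `isUnitaryOf_of_isFor` — every representative `r` of a term of a Hecke element of level `K` lies in `U(H)(E′)`:
  `IsFor` gives `g ∈ U(H)` with `IsCosetReps K.1 g R`, so `r = γ₁ g γ₂` with `γ₁, γ₂ ∈ K.1 ⊆ Γ ⊆ U(H)`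
  (`isUnitaryOf_of_mem_Γ`, `HeckeEquivariance.isUnitaryOf_mul`).

Nothing here asserts anything about the truth of (P); HC_CM is NOT proved by anyone in this repository.
-/

set_option autoImplicit false

noncomputable section

namespace Summit.Ventures.HodgeRepro.Tier4.Line3

open Summit.Ventures.HodgeRepro.Tier4
open Matrix NumberField
open scoped ComplexConjugate

namespace T4Data

variable (X : T4Data)

/-- (G₀): the pointwise Gauss-growth clause of a localiser — `growthInv_of_gaussGrowth`'s hypothesis verbatim. -/
def GaussGrowth (D : X.ThetaData) {p : IsDedekindDomain.HeightOneSpectrum (RingOfIntegers X.E)}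
    {L₀ : Submodule (RingOfIntegers X.E) (Fin 3 → X.E)} {xm : X.Tuple} (ℓ : X.LocS D p L₀ xm) : Prop :=
  ∃ B q₂ c₀ : ℝ, 0 < c₀ ∧ 0 ≤ q₂ ∧ ∀ (N : ℕ) (w : X.LineTuple),
    ‖X.coefQ D.cf (ℓ.loc N) (X.rep w)‖ ≤ B * q₂ ^ N * ∏ k, X.gaussDefAt c₀ (X.rep w k)

/-- (cf-G): the slot coefficient functions are bounded by a constant times the product of the definite Gaussians. -/
def SlotGauss (D : X.ThetaData) : Prop :=
  ∃ C c₀ : ℝ, 0 < c₀ ∧ ∀ (j : Fin 4) (x : Fin 3 → X.E), ‖D.cf j x‖ ≤ C * X.gaussDefAt c₀ x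

/-- **(G₀-b) THE COSET REPRESENTATIVES OF A HECKE ELEMENT OF LEVEL `K` ARE UNITARY**: `IsFor` gives `g ∈ U(H)` with
`IsCosetReps K.1 g t.2`, so `r = γ₁ * g * γ₂` with `γ₁, γ₂ ∈ K.1 ⊆ Γ ⊆ U(H)(E′)`. -/
theorem isUnitaryOf_of_isFor {K : X.Level} {h : HeckeElement X.E} (hh : h.IsFor X.c X.H K.1)
    {t : ℤ × Finset (Matrix (Fin 3) (Fin 3) X.E)} (ht : t ∈ h.terms) {r : Matrix (Fin 3) (Fin 3) X.E} (hr : r ∈ t.2) :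
    IsUnitaryOf X.c X.H r := by
  obtain ⟨g, hg, hreps⟩ := hh t ht
  obtain ⟨γ₁, hγ₁, γ₂, hγ₂, rfl⟩ := hreps.1 r hr
  have hK : K.1 ⊆ X.Γ := K.2.2
  exact HeckeEquivariance.isUnitaryOf_mul X.c X.H
    (HeckeEquivariance.isUnitaryOf_mul X.c X.H (X.isUnitaryOf_of_mem_Γ (hK hγ₁)) hg)
    (X.isUnitaryOf_of_mem_Γ (hK hγ₂))

end T4Data

end Summit.Ventures.HodgeRepro.Tier4.Line3

end
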